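import Literature.Computability.AlgebraicComplexity.BLMW11PermanentApproximationEquivalence
import Literature.Computability.AlgebraicComplexity.ArithCircuitVarsCount
import Literature.Computability.AlgebraicComplexity.BLMW11OrderOfApproximationWs
import HarnessLib

/-!
# BLMW 2011, Prop. 9.4.3 (approximations can be eliminated if Question 9.4.2 has a positive
answer): the closure step and the assembly

Bürgisser–Landsberg–Manivel–Weyman 2011, Prop. 9.4.3 (arXiv:0907.2850, Prop. 9.6, p. 22): "If
Question 9.4.2 has an affirmative answer, then `VP_ws = \overline{VP_ws}`." Printed proof (p. 22):
"Suppose that `(f_m) ∈ \overline{VP_ws}`. Then `\underline{L_ws}(f_m) < n` with `n` polynomially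
bounded in `m`. Hence `f_m` is in the closure of the set of polynomials `g` satisfying
`L_ws(g) < n`. By the universality of the determinant, those polynomials `g` are projections of
`det_n`, hence contained in `\overline{GL_{n²}·det_n}`. It follows that
`f_m ∈ \overline{GL_{n²}·det_n}` [(a)]. If Question 9.4.2 has an affirmative answer, then `f_m`
can be approximated with order at most `q` along a curve in the orbit of `det_n`, where `q` is
polynomially bounded [(b)] … `F := det_n(y_1,…,y_{n²}) = ε^q f_m + ε^{q+1} F̃` … we conclude
`L_ws(F) = m^{O(1)}`. Lemma 9.4.4 tells us that `L_ws(f_m) = O(q² L_ws(F))` [(c)] … This implies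
`(f_m) ∈ VP_ws`."

This file (cell `val-lit`, seat t14; one writer per lemma: part (c) is seat t15's) proves parts
(a) and (b) and assembles the fact `BLMW2011_prop_9_4_3` modulo an explicit form of (c):

* (a) needs two corrections of the print, both supplied here: `f_m` is neither homogeneous of
  degree `n` nor a polynomial in the `n²` matrix variables. We (i) shrink `f_m` to the
  `≤ 2·\underline{L_ws}(f_m) + 1` variables it actually uses — "few variables" passes to the
  Zariski closure because a finite union of coordinate subspaces is closed
  (`mem_zariskiClosure_biUnion`, `card_vars_le_of_coeffVec_mem_zariskiClosure`) — and (ii) replace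
  `f_m` by its homogenisation `∑_i ℓ^{N-i}(f_m)_i` placed in an `N × N` matrix of variables, which
  lies in `Δ[det_N]` (`homogenization_mem_orbitClosure_detPoly_of_mem_zariskiClosure`, the
  per-free form of `BLMW11HomogenizedDetRepresentations.lean`) and of which `f_m` is a projection
  (`isProjection_homogenization`, "substituting `ℓ` by `1`"); the universality step is the tree's
  theorem `BLMW2011_sec9_detVPws_holds` (iii) via `hasDetRepr_of_wsComplexity_le_of_skew_le_ws`.
  Orbit closures are transported along the variable bijection `Fin N × Fin N ≃ Fin (N·N)` of the
  typed Question 9.4.2 (`rename_mem_orbitClosure_of_isHomogeneous`, through `End`-orbits).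
* (b) is the hypothesis `BLMW2011_question_9_4_2` unpacked.
* `BLMW2011_prop_9_4_3_of_orderBound` — **Prop. 9.4.3 from any polynomial order bound (c)**:
  `∀ N q F, IsApproxAlongOrbitOfOrder (det_N) F q → L_ws(F) ≤ Φ N q` with `Φ` p-bounded-composable.

Theorems only; no definitions, no named facts. Nothing here asserts Question 9.4.2 (open) or any
separation of `VP_ws` from `VNP`.

## References
* [BLMW 2011] SIAM J. Comput. 40 (2011), §9.4, Prop. 9.4.3 and Lemma 9.4.4 (arXiv Prop. 9.6,
  Lemma 9.7, p. 22). Bib key `BurgisserEtAl2011`.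
-/

open MvPolynomial

namespace Literature.Computability.AlgebraicComplexity

/-! ### Zariski closure of finite unions; "few variables" passes to the closure -/

section Unions

variable {k : Type*} [Field k] {ι : Type*}

/-- The Zariski closure of `A ∪ B` is contained in the union of the closures (product of two test
polynomials; `k` is a field). [cite: MulmuleySohoni2001, §4] -/
theorem mem_zariskiClosure_union {A B : Set (ι → k)} {x : ι → k}
    (h : x ∈ zariskiClosure (A ∪ B)) : x ∈ zariskiClosure A ∨ x ∈ zariskiClosure B := by
  by_contra hx
  rw [not_or, mem_zariskiClosure_iff, mem_zariskiClosure_iff] at hx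
  obtain ⟨ha, hb⟩ := hx
  push Not at ha hb
  obtain ⟨p, hpA, hpx⟩ := ha
  obtain ⟨q, hqB, hqx⟩ := hb
  have h' := (mem_zariskiClosure_iff.mp h) (p * q) (by
    rintro y (hy | hy)
    · rw [map_mul, hpA y hy, zero_mul]
    · rw [map_mul, hqB y hy, mul_zero])
  rw [map_mul] at h'
  exact (mul_ne_zero hpx hqx) h'

/-- Nothing lies in the Zariski closure of the empty set (the constant test polynomial `1`).
[cite: MulmuleySohoni2001, §4] -/
theorem not_mem_zariskiClosure_empty (x : ι → k) : x ∉ zariskiClosure (∅ : Set (ι → k)) := by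
  intro h
  have h' := (mem_zariskiClosure_iff.mp h) 1 (by simp)
  simp at h'

/-- The Zariski closure of a finite union is contained in the union of the closures.
[cite: MulmuleySohoni2001, §4] -/
theorem mem_zariskiClosure_biUnion {α : Type*} [DecidableEq α] (s : Finset α)
    (A : α → Set (ι → k)) {x : ι → k} (h : x ∈ zariskiClosure (⋃ a ∈ s, A a)) :
    ∃ a ∈ s, x ∈ zariskiClosure (A a) := by
  induction s using Finset.induction_on with
  | empty =>
    simp only [Finset.notMem_empty, Set.iUnion_of_empty, Set.iUnion_empty] at h
    exact absurd h (not_mem_zariskiClosure_empty x)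
  | insert a s ha ih =>
    rw [Finset.set_biUnion_insert] at h
    rcases mem_zariskiClosure_union h with h1 | h2
    · exact ⟨a, Finset.mem_insert_self a s, h1⟩
    · obtain ⟨b, hb, hbx⟩ := ih h2
      exact ⟨b, Finset.mem_insert_of_mem hb, hbx⟩

variable {σ : Type*}

/-- **"Few variables" passes to the Zariski closure**: if every member of `S` involves at most `m`
variables (out of finitely many), so does every polynomial in the closure of `coeffVec '' S` — the
sets `{g | vars g ⊆ T}` (`#T ≤ m`) are coordinate subspaces, finitely many of them.
(Needed because the members of `{g | L_ws(g) ≤ r}` involve `≤ 2r+1` variables each; BLMW 2011,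
proof of Prop. 9.4.3, where the print tacitly places `f_m` among the `n²` matrix variables.)
[cite: BurgisserEtAl2011, Prop. 9.4.3 (proof)] -/
theorem card_vars_le_of_coeffVec_mem_zariskiClosure [Fintype σ] [DecidableEq σ]
    {S : Set (MvPolynomial σ k)} {m : ℕ} (hS : ∀ g ∈ S, g.vars.card ≤ m)
    {f : MvPolynomial σ k} (hf : coeffVec f ∈ zariskiClosure (coeffVec '' S)) :
    f.vars.card ≤ m := by
  classical
  -- decompose `S` by the variable set
  set P : Finset (Finset σ) := (Finset.univ : Finset (Finset σ)).filter (fun T => T.card ≤ m)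
    with hP
  have hdec : coeffVec '' S ⊆ ⋃ T ∈ P, coeffVec '' {g : MvPolynomial σ k | g ∈ S ∧ g.vars ⊆ T} := by
    rintro _ ⟨g, hg, rfl⟩
    simp only [Set.mem_iUnion, Set.mem_image, Set.mem_setOf_eq]
    exact ⟨g.vars, by simp [hP, hS g hg], g, ⟨hg, subset_rfl⟩, rfl⟩
  obtain ⟨T, hT, hfT⟩ := mem_zariskiClosure_biUnion P _ (zariskiClosure_mono hdec hf)
  have hTm : T.card ≤ m := by simpa [hP] using hT
  -- coordinates outside `T` vanish on the piece, hence on `f`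
  have hvars : f.vars ⊆ T := by
    intro i hi
    rw [mem_vars_iff_mem_support] at hi
    obtain ⟨d, hd, hid⟩ := hi
    by_contra hiT
    refine (mem_support_iff.mp hd) (coeff_eq_zero_of_coeffVec_mem_zariskiClosure hfT ?_)
    rintro g ⟨-, hgT⟩
    by_contra hne
    have : i ∈ g.vars := (mem_vars_iff_mem_support i).mpr ⟨d, mem_support_iff.mpr hne, hid⟩
    exact hiT (hgT this)
  exact (Finset.card_le_card hvars).trans hTm

end Unions

/-! ### Orbit closures via `End`-orbits; transport along a bijection of the variables -/

section OrbitTransport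

variable {k : Type*} [Field k] {σ τ : Type*} [Fintype σ] [DecidableEq σ] [Fintype τ]
  [DecidableEq τ]

/-- Over an infinite field the orbit closure is the closure of the `End`-orbit:
`g ∈ Δ[f] ↔ coeffVec g ∈ zcl(coeffVec '' End·f)` (`GL ⊆ End` and `End·f ⊆ Δ[f]`,
`endOrbit_subset_orbitClosure_holds`). [cite: MulmuleySohoni2001, §4] -/
theorem mem_orbitClosure_iff_endOrbit [Infinite k] {f g : MvPolynomial σ k} :
    g ∈ orbitClosure f ↔ coeffVec g ∈ zariskiClosure (coeffVec '' endOrbit σ k f) := by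
  constructor
  · intro h
    refine zariskiClosure_mono (Set.image_mono ?_) h
    rintro _ ⟨A, rfl⟩
    exact ⟨(A : Matrix σ σ k), by simp only [linSubstRep_apply]⟩
  · intro h
    have hsub : coeffVec '' endOrbit σ k f ⊆ zariskiClosure (coeffVec '' glOrbit σ k f) := by
      rintro _ ⟨g', hg', rfl⟩
      exact endOrbit_subset_orbitClosure_holds f hg'
    exact zariskiClosure_image_subset_of_subset hsub h

omit [DecidableEq σ] [DecidableEq τ] in
/-- Renaming along a bijection conjugates linear substitutions:
`e_* (A · p) = (A reindexed by e) · (e_* p)` (private copy of the public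
`rename_linSubst_equiv` of `PolynomialKoszulYoungFlatteningMonotone.lean`, whose imports are not
wanted here). [cite: MulmuleySohoni2001, §4] -/
private theorem rename_linSubst_equiv' (e : σ ≃ τ) (A : Matrix σ σ k) (p : MvPolynomial σ k) :
    rename e (linSubst σ k A p) = linSubst τ k (A.submatrix e.symm e.symm) (rename e p) := by
  have h : (rename e : MvPolynomial σ k →ₐ[k] MvPolynomial τ k).comp (linSubst σ k A) =
      (linSubst τ k (A.submatrix e.symm e.symm)).comp (rename e) := by
    refine MvPolynomial.algHom_ext fun i => ?_
    simp only [AlgHom.comp_apply, linSubst_X, rename_X, map_sum, map_smul]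
    rw [← Equiv.sum_comp e]
    simp [Matrix.submatrix_apply]
  exact DFunLike.congr_fun h p

omit [DecidableEq σ] [DecidableEq τ] in
/-- Renaming along a bijection maps `End`-orbits into `End`-orbits. [cite: MulmuleySohoni2001, §4] -/
theorem rename_image_endOrbit_subset (e : σ ≃ τ) (p : MvPolynomial σ k) :
    rename e '' endOrbit σ k p ⊆ endOrbit τ k (rename e p) := by
  rintro _ ⟨_, ⟨A, rfl⟩, rfl⟩
  exact ⟨A.submatrix e.symm e.symm, (rename_linSubst_equiv' e A p).symm⟩

/-- **Orbit closures are transported along bijections of the variables** (for a form `f`):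
`g ∈ Δ[f] ⇒ e_* g ∈ Δ[e_* f]` — Zariski-closure transport under the linear map `rename e` on the
bounded-degree set `End·f` (`coeffVec_linearMap_mem_zariskiClosure`). Used to pass between the
tree's `detPoly (Fin N)` (variables `Fin N × Fin N`) and the variables `Fin (N·N)` of the typed
Question 9.4.2. [cite: BurgisserEtAl2011, §9.4 (Question 9.4.2)] -/
theorem rename_mem_orbitClosure_of_isHomogeneous [Infinite k] (e : σ ≃ τ) {f g : MvPolynomial σ k}
    {d : ℕ} (hf : f.IsHomogeneous d) (hg : g ∈ orbitClosure f) :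
    rename e g ∈ orbitClosure (rename e f) := by
  rw [mem_orbitClosure_iff_endOrbit] at hg ⊢
  have hS : ∀ g' ∈ endOrbit σ k f, g'.support ⊆ (Finset.range (d + 1)).biUnion
      (fun n => (Finset.univ : Finset σ).finsuppAntidiag n) := by
    rintro _ ⟨A, rfl⟩
    exact support_subset_degBox_of_totalDegree_le (linSubst_isHomogeneous A hf).totalDegree_le
  have h := coeffVec_linearMap_mem_zariskiClosure
    (rename e : MvPolynomial σ k →ₐ[k] MvPolynomial τ k).toLinearMap hS hg
  exact zariskiClosure_mono (Set.image_mono (rename_image_endOrbit_subset e f)) h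

end OrbitTransport

/-! ### Part (a): closure of `{dc ≤ N}` maps into `Δ[det_N]` under homogenisation -/

section Homogenization

/-- **BLMW 2011, proof of Prop. 9.4.3, part (a) (per-free form of the proof of Prop. 9.3.2):**
if `f` lies in the Zariski closure of a set of polynomials each having an affine determinantal
representation of size `N`, then its homogenisation `∑_{i ≤ N} X_y^{N-i} f_i(X_ι)` lies in
`Δ[det_N] = \overline{GL_{N²}·det_N}` — transport along the linear homogenisation map
(`coeffVec_linearMap_mem_zariskiClosure`), `homogenization_mem_endOrbit_detPoly`,
`End·det_N ⊆ Δ[det_N]`. [cite: BurgisserEtAl2011, Prop. 9.4.3 (proof, "It follows that f_m ∈ closure of GL·det_n")] -/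
theorem homogenization_mem_orbitClosure_detPoly_of_mem_zariskiClosure {σ : Type*} [Fintype σ]
    [DecidableEq σ] {N : ℕ} {S : Set (MvPolynomial σ ℂ)} (hS : ∀ g ∈ S, HasDetRepr g N)
    {f : MvPolynomial σ ℂ} (hf : coeffVec f ∈ zariskiClosure (coeffVec '' S))
    (ι : σ → Fin N × Fin N) (y : Fin N × Fin N) :
    (∑ i ∈ Finset.range (N + 1), X y ^ (N - i) * rename ι (homogeneousComponent i f)) ∈
      orbitClosure (detPoly (Fin N) ℂ) := by
  classical
  set L : MvPolynomial σ ℂ →ₗ[ℂ] MvPolynomial (Fin N × Fin N) ℂ :=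
    ∑ i ∈ Finset.range (N + 1), LinearMap.mulLeft ℂ (X y ^ (N - i)) ∘ₗ
      ((rename ι : MvPolynomial σ ℂ →ₐ[ℂ] _).toLinearMap ∘ₗ homogeneousComponent i)
    with hL
  have hLapply : ∀ g : MvPolynomial σ ℂ,
      L g = ∑ i ∈ Finset.range (N + 1), X y ^ (N - i) * rename ι (homogeneousComponent i g) := by
    intro g
    simp only [hL, LinearMap.sum_apply, LinearMap.comp_apply, LinearMap.mulLeft_apply,
      AlgHom.toLinearMap_apply]
  have hSB : ∀ g ∈ S, g.support ⊆ (Finset.range (N + 1)).biUnion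
      (fun n => (Finset.univ : Finset σ).finsuppAntidiag n) :=
    fun g hg => support_subset_degBox_of_totalDegree_le (totalDegree_le_of_hasDetRepr_holds (hS g hg))
  have hLf := coeffVec_linearMap_mem_zariskiClosure L hSB hf
  have hLS : coeffVec '' (L '' S) ⊆
      zariskiClosure (coeffVec '' glOrbit (Fin N × Fin N) ℂ (detPoly (Fin N) ℂ)) := by
    rintro _ ⟨_, ⟨g, hg, rfl⟩, rfl⟩
    have hmem : L g ∈ orbitClosure (detPoly (Fin N) ℂ) := by
      rw [hLapply]
      exact endOrbit_subset_orbitClosure_holds _ (homogenization_mem_endOrbit_detPoly (hS g hg) ι y)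
    exact hmem
  have h := zariskiClosure_image_subset_of_subset hLS hLf
  rw [hLapply] at h
  exact h

/-- **"Substituting `ℓ` by `1`"**: a polynomial `f` with `deg f ≤ N` is a Valiant projection of its
homogenisation `∑_{i ≤ N} X_y^{N-i} f_i(X_ι)` whenever the placement `ι` is injective and misses
the homogenising variable `y`. [cite: BurgisserEtAl2011, Prop. 9.3.2 (proof, "substituting ℓ by 1")] -/
theorem isProjection_homogenization {σ ρ : Type*} {f : MvPolynomial σ ℂ} {N : ℕ}
    (hN : f.totalDegree ≤ N) (ι : σ → ρ) (hι : Function.Injective ι) (y : ρ)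
    (hy : ∀ v, ι v ≠ y) :
    IsProjection f (∑ i ∈ Finset.range (N + 1), X y ^ (N - i) * rename ι (homogeneousComponent i f)) := by
  classical
  set a : ρ → MvPolynomial σ ℂ := fun p =>
    if h : ∃ v, ι v = p then X h.choose else C 1 with ha
  have hay : a y = C 1 := by
    rw [ha]
    simp only
    rw [dif_neg]
    rintro ⟨v, hv⟩
    exact hy v hv
  have haι : ∀ v, a (ι v) = X v := by
    intro v
    have h : ∃ v', ι v' = ι v := ⟨v, rfl⟩
    rw [ha]
    simp only
    rw [dif_pos h, hι h.choose_spec]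
  refine ⟨a, fun p => ?_, ?_⟩
  · by_cases h : ∃ v, ι v = p
    · exact Or.inl ⟨h.choose, by rw [ha]; exact dif_pos h⟩
    · exact Or.inr ⟨1, by rw [ha]; exact dif_neg h⟩
  · rw [map_sum]
    conv_lhs => rw [← sum_homogeneousComponent_range_of_totalDegree_le f hN]
    refine Finset.sum_congr rfl fun i _ => ?_
    rw [map_mul, map_pow, aeval_X, hay, map_one, one_pow, one_mul, aeval_rename]
    have hcomp : (a ∘ ι) = X := funext fun v => haι v
    rw [hcomp, aeval_X_left_apply]

/-- A placement of `m` variables in row `0` of an `N × N` matrix of variables, columns `1 … m`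
(`m + 1 ≤ N`), injective and missing the entry `(0,0)`. [cite: BurgisserEtAl2011, Prop. 9.4.3 (proof)] -/
theorem exists_injective_placement {m N : ℕ} (h : m + 1 ≤ N) :
    ∃ ι : Fin m → Fin N × Fin N, Function.Injective ι ∧
      ∀ v, ι v ≠ (⟨0, by omega⟩, ⟨0, by omega⟩) := by
  refine ⟨fun v => (⟨0, by omega⟩, ⟨v.1 + 1, by omega⟩), fun v w hvw => ?_, fun v hv => ?_⟩
  · simp only [Prod.mk.injEq, Fin.mk.injEq, true_and] at hvw
    exact Fin.ext (by omega)
  · simp only [Prod.mk.injEq, Fin.mk.injEq, true_and] at hv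
    omega

end Homogenization

/-! ### Shrinking to the variables actually used -/

section Shrink

variable {k : Type*} [CommSemiring k] {σ : Type*} [DecidableEq σ]

/-- A polynomial whose variables lie in a finite set `T` is a renaming of a polynomial in `#T`
variables which is in turn one of its projections (kill the other variables).
[cite: Burgisser2000, Def. 2.6(1)] -/
theorem exists_rename_eq_and_isProjection (f : MvPolynomial σ k) :
    ∃ g : MvPolynomial (Fin f.vars.card) k,
      rename (fun i => ((f.vars.equivFin.symm i : f.vars) : σ)) g = f ∧ IsProjection g f := by
  classical
  set emb : Fin f.vars.card → σ := fun i => ((f.vars.equivFin.symm i : f.vars) : σ) with hemb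
  have hinj : Function.Injective emb := by
    intro i j hij
    have : f.vars.equivFin.symm i = f.vars.equivFin.symm j := Subtype.ext hij
    exact f.vars.equivFin.symm.injective this
  have hrange : (↑f.vars : Set σ) ⊆ Set.range emb := by
    intro v hv
    exact ⟨f.vars.equivFin ⟨v, hv⟩, by simp [hemb]⟩
  obtain ⟨g, hg⟩ := exists_rename_eq_of_vars_subset_range f emb hinj hrange
  refine ⟨g, hg, ?_⟩
  -- `g` is the projection of `f` killing the variables outside `vars f`
  set π : σ → MvPolynomial (Fin f.vars.card) k := fun v =>
    if h : v ∈ f.vars then X (f.vars.equivFin ⟨v, h⟩) else C 0 with hπ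
  refine ⟨π, fun v => ?_, ?_⟩
  · by_cases h : v ∈ f.vars
    · exact Or.inl ⟨_, by rw [hπ]; exact dif_pos h⟩
    · exact Or.inr ⟨0, by rw [hπ]; exact dif_neg h⟩
  · have hcomp : (π ∘ emb) = X := by
      funext i
      have hmem : emb i ∈ f.vars := (f.vars.equivFin.symm i).2
      simp only [Function.comp_apply]
      rw [hπ]
      simp only
      rw [dif_pos hmem]
      congr 1
      have : (⟨emb i, hmem⟩ : f.vars) = f.vars.equivFin.symm i := Subtype.ext rfl
      rw [this, Equiv.apply_symm_apply]
    have h1 : aeval π (rename emb g) = g := by rw [aeval_rename, hcomp, aeval_X_left_apply]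
    calc g = aeval π (rename emb g) := h1.symm
      _ = aeval π f := by rw [hg]

end Shrink

/-! ### Degree from bounded support -/

section Degree

variable {k : Type*} [CommSemiring k] {σ : Type*} [Fintype σ] [DecidableEq σ]

/-- A polynomial supported in the monomials of degree `≤ D` has total degree `≤ D`.
[cite: BurgisserEtAl2011, §9.3 (Def. 9.3.1)] -/
theorem totalDegree_le_of_support_subset_degBox {g : MvPolynomial σ k} {D : ℕ}
    (h : g.support ⊆ (Finset.range (D + 1)).biUnion
      (fun n => (Finset.univ : Finset σ).finsuppAntidiag n)) :
    g.totalDegree ≤ D := by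
  rw [totalDegree]
  refine Finset.sup_le fun d hd => ?_
  have hd' := mem_degBox_iff.mp (h hd)
  have : d.degree = d.sum fun _ e => e := rfl
  omega

end Degree

/-! ### Assembly: Prop. 9.4.3 from an order bound (part (c)) -/

section Assembly

/-- **BLMW 2011, Prop. 9.4.3, pointwise core.** For a polynomial `f` in `v` variables with
`\underline{L_ws}(f) ≤ r`, a positive answer to Question 9.4.2 with exponent `c`, and an order
bound (c) `Φ`: there are `N ≤ 3 c₃ r + 3 r + 3` and `q ≤ N^c + c` with `L_ws(f) ≤ Φ N q` (here
`c₃` is the constant of conjunct (iii) of `BLMW2011_sec9_detVPws`). Steps: shrink `f` to its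
`≤ 2r+1` variables (`card_vars_le_of_coeffVec_mem_zariskiClosure`, `card_vars_le_of_computes`);
universality `L_ws ≤ r ⇒ dc ≤ 3c₃r+1` (`hasDetRepr_of_wsComplexity_le_of_skew_le_ws`); part (a);
transport to `Fin (N·N)`; Question 9.4.2; part (c); dehomogenise by projection.
[cite: BurgisserEtAl2011, Prop. 9.4.3 (proof)] -/
theorem exists_wsComplexity_le_of_orderBound (Φ : ℕ → ℕ → ℕ)
    (hc : ∀ (N q : ℕ) (F : MvPolynomial (Fin (N * N)) ℂ),
      IsApproxAlongOrbitOfOrder (rename finProdFinEquiv (detPoly (Fin N) ℂ)) F q →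
        wsComplexity F ≤ Φ N q)
    {cQ : ℕ} (hQ : ∀ (n : ℕ) (f : MvPolynomial (Fin (n * n)) ℂ),
      f ∈ orbitClosure (rename finProdFinEquiv (detPoly (Fin n) ℂ)) →
        ∃ q ≤ n ^ cQ + cQ, IsApproxAlongOrbitOfOrder (rename finProdFinEquiv (detPoly (Fin n) ℂ)) f q)
    (c₃ : ℕ) (hc₃ : ∀ {σ : Type} [Fintype σ] (g : MvPolynomial σ ℂ),
      skewComplexity g ≤ c₃ * wsComplexity g)
    {v : ℕ} (f : MvPolynomial (Fin v) ℂ) {r : ℕ} (hr : approxWsComplexity f ≤ r) :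
    ∃ N q : ℕ, N ≤ 3 * (c₃ * r) + 3 * r + 3 ∧ q ≤ N ^ cQ + cQ ∧ wsComplexity f ≤ Φ N q := by
  classical
  -- (i) `f` involves at most `2r+1` variables
  have hfew : f.vars.card ≤ 2 * r + 1 := by
    refine card_vars_le_of_coeffVec_mem_zariskiClosure (S := {g : MvPolynomial (Fin v) ℂ |
      wsComplexity g ≤ approxWsComplexity f}) (fun g hg => ?_)
      (coeffVec_mem_zariskiClosure_approxWsComplexity f)
    obtain ⟨P, _, h2, _, hcomp, hsz⟩ := HI16Skew.wsComplexity_attained g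
    have h := card_vars_le_of_computes h2 hcomp
    have : P.size ≤ r := by rw [hsz]; exact le_trans hg hr
    omega
  -- (ii) shrink
  obtain ⟨g, hgf, hproj⟩ := exists_rename_eq_and_isProjection f
  have hgr : approxWsComplexity g ≤ r := hproj.approxWsComplexity_le.trans hr
  -- (iii) the size `N`
  set N : ℕ := 3 * (c₃ * r) + r + f.vars.card + 2 with hN
  haveI : NeZero N := ⟨by rw [hN]; omega⟩
  have hmN : f.vars.card + 1 ≤ N := by rw [hN]; omega
  obtain ⟨ι, hι, hιy⟩ := exists_injective_placement hmN
  set y : Fin N × Fin N := (⟨0, by omega⟩, ⟨0, by omega⟩) with hy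
  -- universality: the approximants of `g` have `dc ≤ N`
  have hS : ∀ g' ∈ {g' : MvPolynomial (Fin f.vars.card) ℂ |
      wsComplexity g' ≤ approxWsComplexity g}, HasDetRepr g' N := by
    intro g' hg'
    refine HasDetRepr.mono_holds
      (hasDetRepr_of_wsComplexity_le_of_skew_le_ws c₃ hc₃ g' (le_trans hg' hgr)) ?_
    rw [hN]; omega
  -- (a) the homogenisation of `g` lies in `Δ[det_N]`
  set H : MvPolynomial (Fin N × Fin N) ℂ :=
    ∑ i ∈ Finset.range (N + 1), X y ^ (N - i) * rename ι (homogeneousComponent i g) with hH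
  have hHmem : H ∈ orbitClosure (detPoly (Fin N) ℂ) :=
    homogenization_mem_orbitClosure_detPoly_of_mem_zariskiClosure hS
      (coeffVec_mem_zariskiClosure_approxWsComplexity g) ι y
  -- transport to the variables `Fin (N * N)`
  have hdet : (detPoly (Fin N) ℂ).IsHomogeneous N := by
    simpa using (detPoly_isHomogeneous (n := Fin N) (k := ℂ))
  have hH' := rename_mem_orbitClosure_of_isHomogeneous
    (finProdFinEquiv (m := N) (n := N)) hdet hHmem
  -- (b) Question 9.4.2, then (c)
  obtain ⟨q, hq, happrox⟩ := hQ N _ hH'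
  have hwsH' := hc N q _ happrox
  -- dehomogenise: `L_ws(f) ≤ L_ws(g) ≤ L_ws(H) = L_ws(H') ≤ Φ N q`
  have hdegg : g.totalDegree ≤ N := by
    have hsupp := support_subset_of_coeffVec_mem_zariskiClosure
      (fun g' (hg' : g' ∈ {g' : MvPolynomial (Fin f.vars.card) ℂ |
        wsComplexity g' ≤ approxWsComplexity g}) => support_subset_degBox_of_wsComplexity_le hg')
      (coeffVec_mem_zariskiClosure_approxWsComplexity g)
    have := totalDegree_le_of_support_subset_degBox hsupp
    have h' : approxWsComplexity g ≤ r := hgr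
    rw [hN]; omega
  have hprojg : IsProjection g H := by
    rw [hH]
    exact isProjection_homogenization hdegg ι hι y hιy
  refine ⟨N, q, by rw [hN]; omega, hq, ?_⟩
  calc wsComplexity f = wsComplexity (rename (fun i => ((f.vars.equivFin.symm i : f.vars) : Fin v)) g) := by
          rw [hgf]
    _ ≤ wsComplexity g := (isProjection_rename _ g).wsComplexity_le
    _ ≤ wsComplexity H := hprojg.wsComplexity_le
    _ = wsComplexity (rename (finProdFinEquiv (m := N) (n := N)) H) :=
          (wsComplexity_rename_equiv _ H).symm
    _ ≤ Φ N q := hwsH'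

/-- **BLMW 2011, Prop. 9.4.3 from an order bound (part (c)).** Let `Φ N q` bound the weakly-skew
complexity of every `F` approximated with order `≤ q` along a curve in the orbit of `det_N` (the
content of BLMW Lemma 9.4.4 + "`L_ws(F) = m^{O(1)}`", part (c), cell `val-lit` seat t15), with `Φ`
composable with p-bounded functions. Then Prop. 9.4.3 holds: a positive answer to Question 9.4.2
gives `\overline{VP_ws} = VP_ws` (for families in variables `Fin (v n)`). The universality step uses
the tree's theorem `BLMW2011_sec9_detVPws_holds` (iii). [cite: BurgisserEtAl2011, Prop. 9.4.3] -/
theorem BLMW2011_prop_9_4_3_of_orderBound (Φ : ℕ → ℕ → ℕ)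
    (hΦ : ∀ a b : ℕ → ℕ, IsPBounded a → IsPBounded b → IsPBounded fun n => Φ (a n) (b n))
    (hc : ∀ (N q : ℕ) (F : MvPolynomial (Fin (N * N)) ℂ),
      IsApproxAlongOrbitOfOrder (rename finProdFinEquiv (detPoly (Fin N) ℂ)) F q →
        wsComplexity F ≤ Φ N q) :
    BLMW2011_prop_9_4_3 := by
  intro hQ v f
  refine ⟨fun hbar => ?_, IsVPwsFamily.isVPwsBarFamily⟩
  obtain ⟨cQ, hQ'⟩ := hQ
  obtain ⟨a, ha⟩ := hbar
  obtain ⟨c₃, hc₃⟩ := BLMW2011_sec9_detVPws_holds.2.2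
  have key := fun n => exists_wsComplexity_le_of_orderBound Φ hc hQ' c₃ hc₃ (f n) (ha n)
  choose N q hN hq hws using key
  have hNp : IsPBounded N := by
    refine IsPBounded.mono (t := fun n => 3 * (c₃ * (n ^ a + a)) + 3 * (n ^ a + a) + 3) ?_ hN
    have hr : IsPBounded fun n => n ^ a + a :=
      IsPBounded.add_holds (IsPBounded.pow_holds IsPBounded.id a) (IsPBounded.const a)
    exact IsPBounded.add_holds (IsPBounded.add_holds
      (IsPBounded.mul_holds (IsPBounded.const 3) (IsPBounded.mul_holds (IsPBounded.const c₃) hr))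
      (IsPBounded.mul_holds (IsPBounded.const 3) hr)) (IsPBounded.const 3)
  have hqp : IsPBounded q :=
    IsPBounded.mono (t := fun n => N n ^ cQ + cQ)
      (IsPBounded.add_holds (IsPBounded.pow_holds hNp cQ) (IsPBounded.const cQ)) hq
  exact (hΦ N q hNp hqp).mono hws

/-- The explicit order bound (c) of seat t15 (`ArithCircuit.wsComplexity_le_of_isApproxAlongOrbitOfOrder`,
`BLMW11OrderOfApproximationWs.lean`: `L_ws(F) ≤ (q·deg g + 1)·4·(M(M+1) + (2M+2)·4·L_ws(g)) + (q·deg g + 2)`,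
`M = N²` variables) specialised to `g = det_N` (`deg det_N ≤ N`, `L_ws(det_N) ≤ (N+2)(4N³+7)²`):
a polynomial majorant in `N` and `q`. [cite: BurgisserEtAl2011, §9.4 (proof of Prop. 9.4.3, Lemma 9.4.4)] -/
theorem wsComplexity_le_of_isApproxAlongOrbitOfOrder_detPoly (N q : ℕ)
    (F : MvPolynomial (Fin (N * N)) ℂ)
    (h : IsApproxAlongOrbitOfOrder (rename finProdFinEquiv (detPoly (Fin N) ℂ)) F q) :
    wsComplexity F ≤
      (q * N + 1) * (4 * (N * N * (N * N + 1) +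
        (2 * (N * N) + 2) * (4 * ((N + 2) * (4 * N ^ 3 + 7) ^ 2)))) + (q * N + 1 + 1) := by
  have h1 := ArithCircuit.wsComplexity_le_of_isApproxAlongOrbitOfOrder h
  have hdeg : (rename (finProdFinEquiv (m := N) (n := N)) (detPoly (Fin N) ℂ)).totalDegree ≤ N := by
    refine (totalDegree_rename_le _ _).trans ?_
    simpa using (detPoly_isHomogeneous (n := Fin N) (k := ℂ)).totalDegree_le
  have hws : wsComplexity (rename (finProdFinEquiv (m := N) (n := N)) (detPoly (Fin N) ℂ)) ≤
      (N + 2) * (4 * N ^ 3 + 7) ^ 2 := by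
    rw [wsComplexity_rename_equiv]
    exact HI16Skew.wsComplexity_detPoly_le ℂ N
  refine h1.trans ?_
  gcongr

/-- **Discharge of `BLMW2011_prop_9_4_3` (BLMW 2011, Prop. 9.4.3): if Question 9.4.2 has an
affirmative answer then `VP_ws = \overline{VP_ws}`** (for families in variables `Fin (v n)`; the
typed fact). Parts (a)(b) and the assembly are this file's `BLMW2011_prop_9_4_3_of_orderBound`;
part (c) is seat t15's `ArithCircuit.wsComplexity_le_of_isApproxAlongOrbitOfOrder`
(`BLMW11OrderOfApproximationWs.lean`), specialised to `det_N` above; the universality step is the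
tree's `BLMW2011_sec9_detVPws_holds`. Question 9.4.2 itself is OPEN and is the hypothesis of the
statement; nothing is asserted about it or about `VP` vs `VNP`. [cite: BurgisserEtAl2011, Prop. 9.4.3] -/
theorem BLMW2011_prop_9_4_3_holds : BLMW2011_prop_9_4_3 := by
  refine BLMW2011_prop_9_4_3_of_orderBound
    (fun N q => (q * N + 1) * (4 * (N * N * (N * N + 1) +
      (2 * (N * N) + 2) * (4 * ((N + 2) * (4 * N ^ 3 + 7) ^ 2)))) + (q * N + 1 + 1))
    (fun a b ha hb => ?_) wsComplexity_le_of_isApproxAlongOrbitOfOrder_detPoly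
  have hM : IsPBounded fun n => a n * a n := IsPBounded.mul_holds ha ha
  have hW : IsPBounded fun n => (a n + 2) * (4 * a n ^ 3 + 7) ^ 2 :=
    IsPBounded.mul_holds (IsPBounded.add_holds ha (IsPBounded.const 2))
      (IsPBounded.pow_holds (IsPBounded.add_holds (IsPBounded.mul_holds (IsPBounded.const 4)
        (IsPBounded.pow_holds ha 3)) (IsPBounded.const 7)) 2)
  have hqN : IsPBounded fun n => b n * a n + 1 :=
    IsPBounded.add_holds (IsPBounded.mul_holds hb ha) (IsPBounded.const 1)
  exact IsPBounded.add_holds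
    (IsPBounded.mul_holds hqN (IsPBounded.mul_holds (IsPBounded.const 4)
      (IsPBounded.add_holds (IsPBounded.mul_holds hM (IsPBounded.add_holds hM (IsPBounded.const 1)))
        (IsPBounded.mul_holds (IsPBounded.add_holds (IsPBounded.mul_holds (IsPBounded.const 2) hM)
          (IsPBounded.const 2)) (IsPBounded.mul_holds (IsPBounded.const 4) hW)))))
    (IsPBounded.add_holds hqN (IsPBounded.const 1))

end Assembly

end Literature.Computability.AlgebraicComplexity
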